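import Summits.Ventures.PackingBounds.Configurations.E8Design
import Summits.Ventures.PackingBounds.Kissing.DimensionEight

/-!
# Closure properties of `240`-point kissing configurations in `ℝ⁸` (Bannai–Sloane, step (ii), part 1)

Framing: lottery ticket; floor = certified bounds/negative ranges. Venture `PackingBounds` (cell
`pub-packcert`, seat `pub-packcert-energy`).

Let `C ⊂ S⁷` be ANY kissing configuration (unit vectors, pairwise inner products `≤ 1/2`) with `|C| = 240`.
The tree already knows (complementary slackness, `Kissing.kissing_dim8_inner_of_card_eq_240`,
`Config.E8Design.nbrCount8_eq`) that distinct points have inner products in `{-1, -1/2, 0, 1/2}` and that every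
point has exactly one antipode in `C`. Here we add the ROOT-SYSTEM closure of `C`:

* `neg_mem`     : `x ∈ C → -x ∈ C` (antipodality);
* `add_mem`     : `x, y ∈ C`, `⟪x, y⟫ = -1/2` ⟹ `x + y ∈ C` — otherwise `C ∪ {x + y}` would be a kissing
  configuration of `241` points, contradicting `κ(8) ≤ 240` (`Kissing.kissing_dim8_le_240`);
* `sub_mem`     : `⟪x, y⟫ = 1/2` ⟹ `x - y ∈ C`;
* `reflect_mem` : `C` is closed under the reflection `x ↦ x - 2⟪a, x⟫ a` in every `a ∈ C`.

So `√2 · C` is a (simply-laced) root system with `240` roots; this is the input of the classification-free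
uniqueness proof completed in `E8Frame.lean` / `E8Unique.lean` (Bannai–Sloane 1981 Thm 7 = SPLAG Ch. 14 Thm 7–8,
where the step is done via the classification of root lattices instead).

## References
* E. Bannai, N. J. A. Sloane, *Uniqueness of certain spherical codes*, Canad. J. Math. 33 (1981) 437–449
  (= Conway–Sloane, *SPLAG*, Ch. 14, Theorems 5–8). [`ConwaySloane1999`]
-/

namespace Summit.Ventures.PackingBounds.Config.E8Closure

open Finset

/-- Unit vectors with inner product `-1` are antipodal. -/
theorem eq_neg_of_inner_eq_neg_one {x y : EuclideanSpace ℝ (Fin 8)} (hx : ‖x‖ = 1) (hy : ‖y‖ = 1)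
    (h : inner ℝ x y = -1) : y = -x := by
  have h0 : ‖x + y‖ ^ 2 = 0 := by
    rw [norm_add_sq_real, hx, hy, h]; norm_num
  have : x + y = 0 := by
    rwa [sq_eq_zero_iff, norm_eq_zero] at h0
  exact eq_neg_of_add_eq_zero_right this

/-- Unit vectors with inner product `1` are equal. -/
theorem eq_of_inner_eq_one {x y : EuclideanSpace ℝ (Fin 8)} (hx : ‖x‖ = 1) (hy : ‖y‖ = 1)
    (h : inner ℝ x y = 1) : x = y := by
  have h0 : ‖x - y‖ ^ 2 = 0 := by
    rw [norm_sub_sq_real, hx, hy, h]; norm_num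
  rw [sq_eq_zero_iff, norm_eq_zero, sub_eq_zero] at h0
  exact h0

/-- The inner product of two unit vectors is `< 1` unless they are equal. -/
theorem inner_lt_one_of_ne {x y : EuclideanSpace ℝ (Fin 8)} (hx : ‖x‖ = 1) (hy : ‖y‖ = 1) (hne : x ≠ y) :
    inner ℝ x y < 1 := by
  have hle : inner ℝ x y ≤ 1 := by
    have := real_inner_le_norm x y
    rw [hx, hy] at this
    linarith
  rcases hle.lt_or_eq with h | h
  · exact h
  · exact absurd (eq_of_inner_eq_one hx hy h) hne

/-- Twice a number in `{1, -1, -1/2, 0, 1/2}` is an integer. -/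
theorem exists_int_two_mul_inner_of_cases {t : ℝ}
    (h : t = 1 ∨ t = -1 ∨ t = -1 / 2 ∨ t = 0 ∨ t = 1 / 2) : ∃ m : ℤ, 2 * t = m := by
  rcases h with h | h | h | h | h <;> subst h
  · exact ⟨2, by norm_num⟩
  · exact ⟨-2, by norm_num⟩
  · exact ⟨-1, by norm_num⟩
  · exact ⟨0, by norm_num⟩
  · exact ⟨1, by norm_num⟩

/-- The reflection `x ↦ x - 2⟪a, x⟫ a` in a unit vector `a` is an involution. -/
theorem reflect_reflect {a x : EuclideanSpace ℝ (Fin 8)} (ha : ‖a‖ = 1) :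
    (x - (2 * inner ℝ a x) • a) - (2 * inner ℝ a (x - (2 * inner ℝ a x) • a)) • a = x := by
  have haa : inner ℝ a a = 1 := by rw [real_inner_self_eq_norm_sq, ha, one_pow]
  rw [inner_sub_right, inner_smul_right, haa, mul_one]
  have : (2 : ℝ) * (inner ℝ a x - 2 * inner ℝ a x) = -(2 * inner ℝ a x) := by ring
  rw [this, neg_smul, sub_neg_eq_add, sub_add_cancel]

section config

variable {C : Finset (EuclideanSpace ℝ (Fin 8))} (h1 : ∀ x ∈ C, ‖x‖ = 1)
  (h2 : ∀ x ∈ C, ∀ y ∈ C, x ≠ y → inner ℝ x y ≤ 1 / 2) (hcard : C.card = 240)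
include h1 h2 hcard

/-- The five possible inner products of two (possibly equal) points of a `240`-point kissing configuration. -/
theorem inner_cases {x y : EuclideanSpace ℝ (Fin 8)} (hx : x ∈ C) (hy : y ∈ C) :
    inner ℝ x y = 1 ∨ inner ℝ x y = -1 ∨ inner ℝ x y = -1 / 2 ∨ inner ℝ x y = 0 ∨ inner ℝ x y = 1 / 2 := by
  by_cases hxy : x = y
  · subst hxy
    left
    rw [real_inner_self_eq_norm_sq, h1 x hx, one_pow]
  · right
    exact Kissing.kissing_dim8_inner_of_card_eq_240 C h1 h2 hcard hx hy hxy

/-- `2⟪x, y⟫ ∈ ℤ` for all points `x, y` of a `240`-point kissing configuration. -/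
theorem exists_int_two_mul_inner {x y : EuclideanSpace ℝ (Fin 8)} (hx : x ∈ C) (hy : y ∈ C) :
    ∃ m : ℤ, 2 * inner ℝ x y = m :=
  exists_int_two_mul_inner_of_cases (inner_cases h1 h2 hcard hx hy)

/-- **Antipodality**: a `240`-point kissing configuration in `ℝ⁸` is closed under `x ↦ -x`.
[cite: ConwaySloane1999, Ch. 14 Thm. 5] -/
theorem neg_mem {x : EuclideanSpace ℝ (Fin 8)} (hx : x ∈ C) : -x ∈ C := by
  obtain ⟨hm1, -, -, -⟩ := E8Design.nbrCount8_eq h1 h2 hcard hx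
  have hne : ((C.erase x).filter fun y => inner ℝ x y = -1).Nonempty := by
    rw [← Finset.card_pos]
    unfold E8Design.nbrCount8 at hm1
    omega
  obtain ⟨y, hy⟩ := hne
  rw [Finset.mem_filter] at hy
  have hyC : y ∈ C := Finset.mem_of_mem_erase hy.1
  have : y = -x := eq_neg_of_inner_eq_neg_one (h1 x hx) (h1 y hyC) hy.2
  rw [← this]
  exact hyC

/-- **Closure under root addition**: if `x, y ∈ C` have inner product `-1/2` (angle `120°`), then the unit
vector `x + y` belongs to `C` — otherwise `C ∪ {x + y}` would be a `241`-point kissing configuration.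
[cite: ConwaySloane1999, Ch. 14 Thm. 7] -/
theorem add_mem {x y : EuclideanSpace ℝ (Fin 8)} (hx : x ∈ C) (hy : y ∈ C) (hxy : inner ℝ x y = -1 / 2) : x + y ∈ C := by
  by_contra hz
  set z : EuclideanSpace ℝ (Fin 8) := x + y with hzdef
  have hz1 : ‖z‖ = 1 := by
    have : ‖z‖ ^ 2 = 1 := by
      rw [hzdef, norm_add_sq_real, h1 x hx, h1 y hy, hxy]; norm_num
    have hnn : 0 ≤ ‖z‖ := norm_nonneg _
    nlinarith [this, hnn]
  -- inner products of `z` with points of `C` are at most `1/2`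
  have hzb : ∀ b ∈ C, inner ℝ z b ≤ 1 / 2 := by
    intro b hb
    have hne : z ≠ b := fun h => hz (h ▸ hb)
    have hlt : inner ℝ x b + inner ℝ y b < 1 := by
      have := inner_lt_one_of_ne hz1 (h1 b hb) hne
      rwa [hzdef, inner_add_left] at this
    rw [hzdef, inner_add_left]
    rcases inner_cases h1 h2 hcard hx hb with h | h | h | h | h <;>
      rcases inner_cases h1 h2 hcard hy hb with h' | h' | h' | h' | h' <;>
        (rw [h, h'] at hlt ⊢) <;> first | (norm_num at hlt; done) | norm_num
  have hC' := Kissing.kissing_dim8_le_240 (insert z C) ?_ ?_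
  · rw [Finset.card_insert_of_notMem hz, hcard] at hC'
    omega
  · intro a ha
    rcases Finset.mem_insert.mp ha with rfl | ha
    · exact hz1
    · exact h1 a ha
  · intro a ha b hb hab
    rcases Finset.mem_insert.mp ha with rfl | ha <;> rcases Finset.mem_insert.mp hb with rfl | hb
    · exact absurd rfl hab
    · exact hzb b hb
    · rw [real_inner_comm]; exact hzb a ha
    · exact h2 a ha b hb hab

/-- Closure under root subtraction: `⟪x, y⟫ = 1/2` (angle `60°`) ⟹ `x - y ∈ C`. -/
theorem sub_mem {x y : EuclideanSpace ℝ (Fin 8)} (hx : x ∈ C) (hy : y ∈ C) (hxy : inner ℝ x y = 1 / 2) : x - y ∈ C := by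
  have h := add_mem h1 h2 hcard hx (neg_mem h1 h2 hcard hy) (by rw [inner_neg_right, hxy]; norm_num)
  rwa [← sub_eq_add_neg] at h

/-- **Reflection closure**: `C` is invariant under the reflection in any of its points,
`x ↦ x - 2⟪a, x⟫ a`. Together with `neg_mem`/`add_mem`, `√2 · C` is a root system.
[cite: ConwaySloane1999, Ch. 14 Thm. 7] -/
theorem reflect_mem {a x : EuclideanSpace ℝ (Fin 8)} (ha : a ∈ C) (hx : x ∈ C) : x - (2 * inner ℝ a x) • a ∈ C := by
  rcases inner_cases h1 h2 hcard ha hx with h | h | h | h | h <;> rw [h]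
  · have hxa : a = x := eq_of_inner_eq_one (h1 a ha) (h1 x hx) h
    subst hxa
    have : a - (2 * (1 : ℝ)) • a = -a := by
      rw [mul_one, two_smul]; abel
    rw [this]; exact neg_mem h1 h2 hcard ha
  · have hxa : x = -a := eq_neg_of_inner_eq_neg_one (h1 a ha) (h1 x hx) h
    subst hxa
    have : -a - (2 * (-1 : ℝ)) • a = a := by
      rw [show (2 : ℝ) * -1 = -2 by norm_num, neg_smul, sub_neg_eq_add, two_smul]; abel
    rw [this]; exact ha
  · have : x - (2 * (-1 / 2 : ℝ)) • a = x + a := by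
      rw [show (2 : ℝ) * (-1 / 2) = -1 by norm_num, neg_one_smul, sub_neg_eq_add]
    rw [this]
    exact add_mem h1 h2 hcard hx ha (by rw [real_inner_comm]; exact h)
  · have : x - (2 * (0 : ℝ)) • a = x := by rw [mul_zero, zero_smul, sub_zero]
    rw [this]; exact hx
  · have : x - (2 * (1 / 2 : ℝ)) • a = x - a := by
      rw [show (2 : ℝ) * (1 / 2) = 1 by norm_num, one_smul]
    rw [this]
    exact sub_mem h1 h2 hcard hx ha (by rw [real_inner_comm]; exact h)

/-- The antipodal map is a permutation of `C`. -/
theorem neg_mem_iff {x : EuclideanSpace ℝ (Fin 8)} : -x ∈ C ↔ x ∈ C :=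
  ⟨fun h => by simpa using neg_mem h1 h2 hcard h, neg_mem h1 h2 hcard⟩

end config

end Summit.Ventures.PackingBounds.Config.E8Closure
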